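import Summits.ABC.ABC.Theses.TwistAmplification
import Summits.ABC.ABC.Theorems.SomeWindowSaving.Negative.WindowFinite
import Summits.ABC.ABC.Theorems.SomeWindowSaving.Negative.LoadBearing
import Summits.ABC.ABC.Theorems.SomeWindowSaving.Negative.WindowSavingBelowThird
import Summits.ABC.ABC.Theorems.SomeWindowSaving.Negative.LowerLaw
import Literature.NumberTheory.EllipticCurves.DegreeConjectureAbcSemistable
import Literature.NumberTheory.EllipticCurves.NewformPeterssonSizeProofs
import Literature.NumberTheory.EllipticCurves.SilvermanHeightCovolumeProofs
import Literature.NumberTheory.EllipticCurves.SzpiroFreyProofs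
import Literature.NumberTheory.EllipticCurves.SzpiroBGEquivalenceProofs
import Summits.ABC.ABC.Theses.CMRescueSzpiro

/-!
# Skeleton line `polynomial-degree-suffices` for crux `SomeWindowSaving` (stmt-ABC-1976)
# — LEAD'S RESHAPE (prover-line-stmt-ABC-1976-0, 2026-08-16): the seam moved to the Szpiro level

Route `TwistAmplification`, crux r3 `SomeWindowSaving` =
`∃ κ σ δ C, 3 < κ < σ ∧ δ < (σ−κ)/(2σ−6) ∧ ∀ X ≥ 1, T⁺_[κ,σ](X) ≤ C·X^δ`
(`T⁺` = number of reduced global minimal models `W₀/ℤ`, `c₄c₆ ≠ 0`, conductor `N ≤ X`,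
`N^κ ≤ M⁺ := max(|Δ|,|c₄|³) ≤ N^σ`; `Negative.windowSet` / `windowCount`, `someWindowSaving_iff`).

## LEAD-1 STATE (prover-line-stmt-ABC-1976-1, 2026-08-16)

* STUB 2' is CLOSED in this file: the landed proof (p73891,
  `Summits/ABC/ABC/Theorems/TwistAmplificationSomeWindowSavingZagierSilvermanBridgeSemistable.lean`) is copied
  verbatim into `namespace … .Bridge` below because the farm snapshot has not yet BUILT that module
  (`lean check` rc 75 `remote:stale:…:unbuilt`); swap for the `import` once it is built. Registered stubs left:
  `stub_polyDegreeSemistable` (= stmt-ABC-2046 consequent given stmt-ABC-2045; stub-blocked) and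
  `stub_semistableToAllSzpiro` (open, drefute-survived, crux-sized per lead-0).
* EXISTING-ITEM SUFFICIENCY (new, sorry-free, §"Sufficiency of stmt-ABC-10576" below): the crux as a whole, and the
  conclusions of BOTH open stubs' targets at the Szpiro level, follow from ONE existing item — stmt-ABC-10576,
  `Summit.ABC.ABC.Theses.CMRescueSzpiro.Target`, which is `Iff.rfl` the catalogued conjecture
  `Literature.NumberTheory.EllipticCurves.GeneralizedSzpiroConjectureBG` (B–G Conj. 12.5.11 ≡ ABC by the proved
  `abcLe_iff_generalizedSzpiroBG_holds`). Landed importably as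
  `Summits/ABC/ABC/Theorems/TwistAmplificationSomeWindowSavingInertBox.lean`
  (`someWindowSaving_of_cofiniteWeakGenSzpiro / _of_weakGenSzpiro / _of_generalizedSzpiroBG / _of_abc`).
  Position of the crux, kernel-checked on both sides:
  `stmt-ABC-10576 ⟹ WGS ⟹ crux ⟹[1977,1978; Disproof §1] cofinite WGS ⟹ weak abc`.

## The line (crux idea card `polynomial-degree-suffices`; planner skeleton round 1; lead reshape)

CALIBRATION (standing disprover `someWindowSaving_iff_weakSzpiro`, all three triagers): the crux IS weak
generalized Szpiro with an UNSPECIFIED exponent — `∃ K C, max(|Δ_min|,|c₄|³) ≤ C·N^K` for every elliptic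
curve over `ℚ` ("WGS"). WGS → crux is elementary and PROVED here (`inertBox_holds`).

LEVER (Frey–Murty–Zagier with an INERT exponent): a POLYNOMIAL modular-degree bound `deg φ ≤ C·N^A` for
SOME `A` gives WGS for the curves it covers, through Zagier's identity `4π²c²(f,f) = deg φ · covol(Λ_E)`
(PROVED, `zagier_degree_formula_holds`), the Petersson bound at `ε = 1` (PROVED,
`murty_petersson_newform_lower_bound_of_one_le`) and Silverman's covolume inequality at `ε = 1` (PROVED,
`silverman1986_discriminant_c4_covolume_holds`): `max(|Δ_min|,|c₄|³) ≤ A₁·covol^{−7} ≪ N^{7(2A−3)}`.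

RESHAPE (lead, cycle 1). The planner cut the open content as
`PolyDegreeSemistable →[stub 2: SemistableToAll] PolyDegreeAll →[stub 3: bridge] WGS`. Stub 2 at the DEGREE
level is formally out of reach in this tree for a reason unrelated to its mathematics: its conclusion asks for a
`ModularParametrizationData W N` for EVERY elliptic `W/ℚ`, which exists in the tree only behind named modularity
facts (`nonempty_modularParametrizationData_of_…`, hypotheses `exists_isNewformOf`, Eichler–Shimura, Manin). The
bridge, however, is POINTWISE (one curve, one datum ↦ one Szpiro inequality), so it can be run BEFORE the upgrade.
New cut, same composition idea, same supplied stub: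

  `PolyDegreeSemistable →[stub 2': bridge, semistable] WGS_semistable →[stub 3': additive upgrade] WGS → crux`.

* `stub_polyDegreeSemistable` (UNCHANGED, XL, open, SUPPLIED by route IsogenyGlueCongruence: stmt-ABC-2046 /
  antecedent of stmt-ABC-10895).
* `stub_zagierSilvermanBridgeSemistable` (M, PROVABLE NOW, fact-free): the bridge with the semistability
  hypothesis threaded through (the datum comes from stub 1's conclusion; `deg ≤ C N^κ ≤ max C 1 · c² · N^{max κ 3}`
  since `c ∈ ℤ ∖ {0}`).
* `stub_semistableToAllSzpiro` (XL, OPEN, HARDEST — the lead's stub): `WGS_semistable → WGS_all`, a statement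
  about pointwise invariants of minimal models only (no modular forms). Its `e = 2` part is elementary (an additive
  prime `p ≥ 5` of Kodaira type `I_n^*` is removed by the quadratic twist by `±p`: `N' ∣ N`, `Δ_min' = Δ_min/p⁶`,
  `c₄' = c₄/p²`, and `p² ∣ N`, so `M⁺ ≤ N³·M⁺'`); its residue — potentially good primes `p ≥ 5` with
  `e ∈ {3,4,6}` and the primes `2, 3` — is the honest open core (it contains weak Hall on the Mordell–Hall curves
  `Y² = X³ − 3xX − 2y` that are additive at `2` or `3`; barrier `Literature.Barriers.ABC.HallExponentSharp` recorded).

`SomeWindowSaving_of` composes the three stubs into the crux BY NAME (kernel-checked, no `sorry`):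
`inertBox_holds (h3 (h2 h1))`.

## Disproof used (cdisprove gen-2 FINAL 2026-08-16T00:14Z; `Disproof.lean` itself is not mounted in the lead's
jail and not published under `Cruxes/`; used through its evidence notes and the LANDED `Negative/*`)
* `someWindowSaving_iff_weakSzpiro` (calibration) — HONOURED: the line is pointwise; ⟸ re-proved as
  `inertBox_holds`.
* `someWindowSaving_trivial_without_lowerKappa / upperSigma / threshold` (landed `Negative/LoadBearing.lean`) —
  HONOURED: the InertBox witness is `κ = K'+1 ≥ 4 > 3`, `σ = K'+2 > κ`, `δ = 0 < 1/(2K'−2)`; the window is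
  emptied by WGS beyond conductor `max C 1`, not by a sign trick.
* `not_windowSaving_below_third`, `not_windowSaving_below_law` (landed) — CONSISTENT: the witness has `κ ≥ 4`.
  No `-- Targets` stub kill applies. No landed Negative lemma refutes an instance of any stub.
-/

noncomputable section

open IsDedekindDomain WeierstrassCurve
open Literature.NumberTheory.EllipticCurves
open Literature.NumberTheory.EllipticCurves.ModularForms
open Summit.ABC.ABC.Theses.TwistAmplification
open Summit.ABC.ABC.Theorems.SomeWindowSaving.Negative
open Literature.NumberTheory.DiophantineGeometry (IsABCTriple rad)

set_option linter.dupNamespace false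

namespace Summit.ABC.ABC.Cruxes.SomeWindowSaving.PolynomialDegreeSuffices

/-! ### The statements of the line (named `Prop`s over existing declarations) -/

/-- **Polynomial modular-degree bound, SEMISTABLE curves** (`∃D` form bundling modularity, as in
route `IsogenyGlueCongruence`): there are absolute `κ, C` such that every semistable elliptic
`W/ℚ` in global minimal form admits at level `N = N_W` a modular parametrisation datum with
`deg ≤ C·N^κ`. VERBATIM the consequent of `IsogenyGlueCongruence.PolyDegreeOfBoundedPrimes`
(stmt-ABC-2046) = the antecedent of `IsogenyGlueCongruence.SharpDegreeOfPolyDegree`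
(stmt-ABC-10895) = Frey's height/degree conjecture with a polynomial exponent
(PastenShimura2024 Conj. 3.1/3.2) restricted to semistable curves. -/
def PolyDegreeSemistable : Prop :=
  ∃ κ C : ℝ, ∀ (W : WeierstrassCurve ℚ) [W.IsElliptic] [W.IsGloballyMinimal]
    [NeZero (W.conductorNorm ℤ)], W.IsSemistable ℤ →
      ∃ D : ModularParametrizationData W (W.conductorNorm ℤ),
        (D.modularDegree : ℝ) ≤ C * (W.conductorNorm ℤ : ℝ) ^ κ

/-- **Weak generalized Szpiro, SEMISTABLE curves** (`∃K` form of Bombieri–Gubler Conj. 12.5.11 with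
`6 + ε ↦ K`, restricted to semistable curves), in the crux's own vocabulary: integral models minimal at every
place, `M⁺ = max(|Δ|,|c₄|³)`, `N = conductorNorm`. The output of the bridge run on stub 1's curves. -/
def WeakGeneralizedSzpiroSemistable : Prop :=
  ∃ K C : ℝ, ∀ W₀ : WeierstrassCurve ℤ, (W₀.baseChange ℚ).IsElliptic →
    (∀ v : HeightOneSpectrum ℤ, (W₀.baseChange ℚ).IsMinimalAt v) →
      (W₀.baseChange ℚ).IsSemistable ℤ →
        ((max |W₀.Δ| (|W₀.c₄| ^ 3) : ℤ) : ℝ) ≤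
          C * (((W₀.baseChange ℚ).conductorNorm ℤ : ℕ) : ℝ) ^ K

/-- **Weak generalized Szpiro** (`∃K` form of Bombieri–Gubler Conj. 12.5.11 =
`GeneralizedSzpiroConjectureBG` with `6 + ε ↦ K`), in the crux's own vocabulary. By the disprover's
calibration this is the pointwise content of the crux. -/
def WeakGeneralizedSzpiro : Prop :=
  ∃ K C : ℝ, ∀ W₀ : WeierstrassCurve ℤ, (W₀.baseChange ℚ).IsElliptic →
    (∀ v : HeightOneSpectrum ℤ, (W₀.baseChange ℚ).IsMinimalAt v) →
      ((max |W₀.Δ| (|W₀.c₄| ^ 3) : ℤ) : ℝ) ≤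
        C * (((W₀.baseChange ℚ).conductorNorm ℤ : ℕ) : ℝ) ^ K

/-- **Polynomial modular-degree bound, ALL curves** (`C⁺` of the idea card; the planner's round-1
`PolyDegreeAll`, kept for the ALTERNATIVE composition below): absolute `κ, C` with `deg ≤ C·c²·N^κ` for
some datum `D` (Manin constant `c = D.c ∈ ℤ∖{0}`) of every elliptic `W/ℚ` in global minimal form
(`c²`-normalised, hence datum-independent by Zagier). No typed supplier on the summit outputs it for
additive curves (IsogenyGlueCongruence's U/A/B are semistable-only); if one ever does, the crux follows from
it ALONE through the landed all-curves bridge `Summit.ABC.ABC.Theorems.weakGenSzpiro_of_polyDegreeAll`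
(p73891) and `inertBox_holds` — see the `example` after `SomeWindowSaving_of`. -/
def PolyDegreeAll : Prop :=
  ∃ κ C : ℝ, ∀ (W : WeierstrassCurve ℚ) [W.IsElliptic] [W.IsGloballyMinimal]
    [NeZero (W.conductorNorm ℤ)],
      ∃ D : ModularParametrizationData W (W.conductorNorm ℤ),
        (D.deg : ℝ) ≤ C * (D.c : ℝ) ^ 2 * ((W.conductorNorm ℤ : ℕ) : ℝ) ^ κ

/-- Statement of STUB 2': the Zagier–Petersson–Silverman bridge with an inert exponent, semistable curves. -/
def ZagierSilvermanBridgeSemistable : Prop := PolyDegreeSemistable → WeakGeneralizedSzpiroSemistable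

/-- Statement of STUB 3': the additive upgrade at the Szpiro level. -/
def SemistableToAllSzpiro : Prop := WeakGeneralizedSzpiroSemistable → WeakGeneralizedSzpiro

/-- The card's `InertBox` (proved below, not a stub). -/
def InertBox : Prop := WeakGeneralizedSzpiro → SomeWindowSaving

/-! ### The landed bridge (p73891), inlined

Verbatim copy of the body of the ACCEPTED Theorems file
`Summits/ABC/ABC/Theorems/TwistAmplificationSomeWindowSavingZagierSilvermanBridgeSemistable.lean`
(`namespace Summit.ABC.ABC.Theorems` there; here under `….PolynomialDegreeSuffices.Bridge` so that no name clashes when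
both are in one environment). Present only because the farm snapshot serving `lean check` has not yet built that
module; delete this section and `import` the module once it is built. -/
namespace Bridge

open CongruenceSubgroup


/-- **Real-arithmetic core of the bridge.** If `M ≤ A · covol^{−(6+1)}` and
`κ₀ · N^{−(1+2δ)} ≤ covol` with `κ₀, N, covol > 0`, then
`M ≤ max(A, 0) · κ₀^{−(6+1)} · N^{(1+2δ)(6+1)}`. [folklore] -/
theorem ZagierSilvermanBridge.le_of_covolume_estimates {M A covol κ₀ N δ : ℝ} (hκ₀ : 0 < κ₀)
    (hN : 0 < N) (hcov : 0 < covol) (hM : M ≤ A * covol ^ (-(6 + 1 : ℝ)))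
    (hlow : κ₀ * N ^ (-(1 + 2 * δ)) ≤ covol) :
    M ≤ max A 0 * κ₀ ^ (-(6 + 1 : ℝ)) * N ^ ((1 + 2 * δ) * (6 + 1)) := by
  have hexp : (-(6 + 1 : ℝ)) ≤ 0 := by norm_num
  have hlow0 : 0 < κ₀ * N ^ (-(1 + 2 * δ)) := mul_pos hκ₀ (Real.rpow_pos_of_pos hN _)
  have h2 : covol ^ (-(6 + 1 : ℝ)) ≤ (κ₀ * N ^ (-(1 + 2 * δ))) ^ (-(6 + 1 : ℝ)) :=
    Real.rpow_le_rpow_of_nonpos hlow0 hlow hexp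
  have h3 : (κ₀ * N ^ (-(1 + 2 * δ))) ^ (-(6 + 1 : ℝ)) =
      κ₀ ^ (-(6 + 1 : ℝ)) * N ^ ((1 + 2 * δ) * (6 + 1)) := by
    rw [Real.mul_rpow hκ₀.le (Real.rpow_nonneg hN.le _), ← Real.rpow_mul hN.le]
    congr 1; ring
  have hA : A ≤ max A 0 := le_max_left _ _
  have hA0 : 0 ≤ max A 0 := le_max_right _ _
  have hce : 0 ≤ covol ^ (-(6 + 1 : ℝ)) := Real.rpow_nonneg hcov.le _
  calc M ≤ A * covol ^ (-(6 + 1 : ℝ)) := hM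
    _ ≤ max A 0 * covol ^ (-(6 + 1 : ℝ)) := mul_le_mul_of_nonneg_right hA hce
    _ ≤ max A 0 * (κ₀ ^ (-(6 + 1 : ℝ)) * N ^ ((1 + 2 * δ) * (6 + 1))) :=
        mul_le_mul_of_nonneg_left (h3 ▸ h2) hA0
    _ = _ := by ring

/-- **Degree bookkeeping.** `deg ≤ C · X · N^κ` with `0 ≤ X ≤ Y`, `κ ≤ 2 + δ` and `N ≥ 1` gives
`deg ≤ max(C, 1) · Y · N^{2+δ}`, the shape consumed by `covolume_ge_of_deg_le`. [folklore] -/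
theorem ZagierSilvermanBridge.deg_le_of_le {deg C X Y N κ δ : ℝ} (hN : 1 ≤ N) (hX : 0 ≤ X)
    (hXY : X ≤ Y) (hκ : κ ≤ 2 + δ) (h : deg ≤ C * X * N ^ κ) :
    deg ≤ max C 1 * Y * N ^ (2 + δ) := by
  have hN0 : 0 ≤ N := zero_le_one.trans hN
  have hC : 0 ≤ max C 1 := zero_le_one.trans (le_max_right _ _)
  calc deg ≤ C * X * N ^ κ := h
    _ = C * (X * N ^ κ) := by ring
    _ ≤ max C 1 * (X * N ^ κ) :=
        mul_le_mul_of_nonneg_right (le_max_left _ _) (mul_nonneg hX (Real.rpow_nonneg hN0 _))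
    _ ≤ max C 1 * (Y * N ^ (2 + δ)) :=
        mul_le_mul_of_nonneg_left (mul_le_mul hXY (Real.rpow_le_rpow_of_exponent_le hN hκ)
          (Real.rpow_nonneg hN0 _) (hX.trans hXY)) hC
    _ = _ := by ring

/-- `1 ≤ c²` in `ℝ` for a non-zero integer `c` (applied to the Manin constant). [folklore] -/
theorem ZagierSilvermanBridge.one_le_cast_sq {c : ℤ} (hc : c ≠ 0) : (1 : ℝ) ≤ (c : ℝ) ^ 2 := by
  have h : (1 : ℤ) ≤ c ^ 2 := (one_le_sq_iff_one_le_abs c).mpr (Int.one_le_abs hc)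
  exact_mod_cast h

/-- **The Zagier–Petersson–Silverman bridge, pointwise** (Frey; Murty 1999 Thm. 1; Pasten
arXiv:1705.09251 §3; Silverman 1986 Cor. 2.3). Let `c₂ > 0` be a Petersson constant at exponent
`1 − δ` (`c₂ N^{1−δ} ≤ (f,f)` for every newform of an elliptic curve) and `A` a Silverman
constant at `ε = 1` (`max(|Δ_W|,|c₄(W)|³) ≤ A covol(Λ)^{−7}` for globally minimal `W` and its
Néron lattice). Then for every integral model `W₀` whose base change `W/ℚ` is elliptic and globally
minimal, and every modular parametrisation datum `D` of `W` at a level `N` with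
`deg ≤ C₁ c² N^{2+δ}`:
`max(|Δ_{W₀}|, |c₄(W₀)|³) ≤ max(A,0) · (4π²c₂/C₁)^{−7} · N^{7(1+2δ)}`.
Proof: `covolume_ge_of_deg_le` (Zagier's identity) gives `covol ≥ (4π²c₂/C₁) N^{−(1+2δ)}`,
Silverman bounds `max(|Δ_W|,|c₄(W)|³)` by `A covol^{−7}`, and `Δ_W = Δ_{W₀}`, `c₄(W) = c₄(W₀)`.
[folklore] -/
theorem ZagierSilvermanBridge.pointwise {δ C₁ c₂ A : ℝ} (hC₁ : 0 < C₁) (hc₂ : 0 < c₂)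
    (hP : ∀ (N : ℕ) [NeZero N] (W : WeierstrassCurve ℚ) [W.IsElliptic]
      (f : CuspForm (Gamma0 N) 2), IsNewformOf W f →
        c₂ * (N : ℝ) ^ (1 - δ) ≤ (peterssonProduct (Gamma0 N) 2 f f).re)
    (hA : ∀ (W : WeierstrassCurve ℚ) [W.IsElliptic] [W.IsGloballyMinimal] (L : PeriodPair),
      IsNeronLatticeOf (W.baseChange ℂ) L →
        ((max |W.Δ| (|W.c₄| ^ 3) : ℚ) : ℝ) ≤ A * ZLattice.covolume L.lattice ^ (-(6 + 1 : ℝ)))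
    (W₀ : WeierstrassCurve ℤ) [(W₀.baseChange ℚ).IsElliptic] [(W₀.baseChange ℚ).IsGloballyMinimal]
    {N : ℕ} [NeZero N] (D : ModularParametrizationData (W₀.baseChange ℚ) N)
    (hD : (D.deg : ℝ) ≤ C₁ * (D.c : ℝ) ^ 2 * (N : ℝ) ^ (2 + δ)) :
    ((max |W₀.Δ| (|W₀.c₄| ^ 3) : ℤ) : ℝ) ≤
      max A 0 * (4 * Real.pi ^ 2 * c₂ / C₁) ^ (-(6 + 1 : ℝ)) *
        (N : ℝ) ^ ((1 + 2 * δ) * (6 + 1)) := by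
  have hNpos : (0 : ℝ) < (N : ℝ) := by exact_mod_cast Nat.pos_of_ne_zero (NeZero.ne N)
  have hκ₀ : 0 < 4 * Real.pi ^ 2 * c₂ / C₁ := div_pos (by positivity) hC₁
  -- Zagier + degree bound + Petersson: the covolume of the Néron lattice from below
  have hPD := hP N (W₀.baseChange ℚ) D.f D.isNewformOf
  have hlow := covolume_ge_of_deg_le D hC₁ hD hPD
  -- Silverman for the Néron lattice `D.L` of the minimal model `W₀ ⊗ ℚ`
  have hSW := hA (W₀.baseChange ℚ) D.L D.isNeronLattice
  have hcov : 0 < ZLattice.covolume D.L.lattice := ZLattice.covolume_pos _ _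
  have hmain := ZagierSilvermanBridge.le_of_covolume_estimates hκ₀ hNpos hcov hSW hlow
  -- the invariants of `W₀ ⊗ ℚ` are those of `W₀`
  have hΔW : (W₀.baseChange ℚ).Δ = (W₀.Δ : ℚ) := by
    simp [WeierstrassCurve.baseChange, WeierstrassCurve.map_Δ]
  have hc₄W : (W₀.baseChange ℚ).c₄ = (W₀.c₄ : ℚ) := by
    simp [WeierstrassCurve.baseChange, WeierstrassCurve.map_c₄]
  have e1 : ((max |W₀.Δ| (|W₀.c₄| ^ 3) : ℤ) : ℝ) =
      ((max |(W₀.baseChange ℚ).Δ| (|(W₀.baseChange ℚ).c₄| ^ 3) : ℚ) : ℝ) := by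
    rw [hΔW, hc₄W]; norm_cast
  rw [e1]
  exact hmain

/-- **STUB 2' of line `polynomial-degree-suffices` (crux `SomeWindowSaving`, stmt-ABC-1976):
the Zagier–Petersson–Silverman bridge with an inert exponent, semistable curves.** A polynomial
modular-degree bound `deg φ ≤ C · N^κ` for the semistable elliptic curves over `ℚ` in global
minimal form (with a parametrisation datum at level `N = N_E`) implies weak generalized Szpiro
for every semistable integral model minimal at all places:
`max(|Δ|, |c₄|³) ≤ C' · N^K` with `K = 7(1 + 2δ)`, `δ = max κ 3 − 2`.
Given `W₀`, put `W := W₀ ⊗ ℚ` (globally minimal by `isGloballyMinimal_of_forall_isMinimalAt_int`,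
`N_E > 0` by `conductorNorm_pos_holds`), take the datum `D` of the hypothesis; since the Manin
constant is a non-zero integer (`maninConstant_ne_zero_holds`), `deg ≤ max(C,1) c² N^{2+δ}`;
the Petersson input at exponent `1 − δ ≤ 0` is the proved range
`murty_petersson_newform_lower_bound_of_one_le`, the Silverman input is
`silverman1986_discriminant_c4_covolume_holds 1`; conclude by `ZagierSilvermanBridge.pointwise`.
(Frey 1997 Cor. 3.1; Murty 1999 Thm. 1; Pasten arXiv:1705.09251 §3; Silverman 1986 Cor. 2.3.)
[folklore] -/
theorem stub_zagierSilvermanBridgeSemistable :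
    (∃ κ C : ℝ, ∀ (W : WeierstrassCurve ℚ) [W.IsElliptic] [W.IsGloballyMinimal]
      [NeZero (W.conductorNorm ℤ)], W.IsSemistable ℤ →
        ∃ D : ModularParametrizationData W (W.conductorNorm ℤ),
          (D.modularDegree : ℝ) ≤ C * (W.conductorNorm ℤ : ℝ) ^ κ) →
    ∃ K C : ℝ, ∀ W₀ : WeierstrassCurve ℤ, (W₀.baseChange ℚ).IsElliptic →
      (∀ v : HeightOneSpectrum ℤ, (W₀.baseChange ℚ).IsMinimalAt v) →
        (W₀.baseChange ℚ).IsSemistable ℤ →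
          ((max |W₀.Δ| (|W₀.c₄| ^ 3) : ℤ) : ℝ) ≤
            C * (((W₀.baseChange ℚ).conductorNorm ℤ : ℕ) : ℝ) ^ K := by
  rintro ⟨κ, C, hdeg⟩
  -- uniform constants
  obtain ⟨δ, hδ1, hκδ⟩ : ∃ δ : ℝ, 1 ≤ δ ∧ κ ≤ 2 + δ :=
    ⟨max κ 3 - 2, by have := le_max_right κ 3; linarith, by have := le_max_left κ 3; linarith⟩
  have hC₁ : (0 : ℝ) < max C 1 := one_pos.trans_le (le_max_right _ _)
  obtain ⟨c₂, hc₂, hP⟩ := murty_petersson_newform_lower_bound_of_one_le hδ1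
  obtain ⟨A, hA⟩ := silverman1986_discriminant_c4_covolume_holds 1 one_pos
  refine ⟨(1 + 2 * δ) * (6 + 1), max A 0 * (4 * Real.pi ^ 2 * c₂ / max C 1) ^ (-(6 + 1 : ℝ)),
    fun W₀ hE hmin hss ↦ ?_⟩
  -- the curve: instances, the datum, the degree bound in the shape `deg ≤ C₁ c² N^{2+δ}`
  haveI : (W₀.baseChange ℚ).IsGloballyMinimal :=
    isGloballyMinimal_of_forall_isMinimalAt_int _ hmin
  have hN0 : 0 < (W₀.baseChange ℚ).conductorNorm ℤ := conductorNorm_pos_holds _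
  haveI : NeZero ((W₀.baseChange ℚ).conductorNorm ℤ) := ⟨hN0.ne'⟩
  obtain ⟨D, hD⟩ := hdeg (W₀.baseChange ℚ) hss
  have hN1 : (1 : ℝ) ≤ (((W₀.baseChange ℚ).conductorNorm ℤ : ℕ) : ℝ) := by exact_mod_cast hN0
  have hc0 : D.maninConstant ≠ 0 := D.maninConstant_ne_zero_holds
  have hc1 : (1 : ℝ) ≤ (D.c : ℝ) ^ 2 := ZagierSilvermanBridge.one_le_cast_sq hc0
  have hD1 : (D.deg : ℝ) ≤ C * 1 * (((W₀.baseChange ℚ).conductorNorm ℤ : ℕ) : ℝ) ^ κ := by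
    rw [mul_one]; exact hD
  have hD' := ZagierSilvermanBridge.deg_le_of_le hN1 zero_le_one hc1 hκδ hD1
  exact ZagierSilvermanBridge.pointwise hC₁ hc₂ hP hA W₀ D hD'

/-- **The bridge for all curves** (corollary of `ZagierSilvermanBridge.pointwise`): a polynomial
modular-degree bound in the form `deg ≤ C · c² · N^κ` for EVERY elliptic curve over `ℚ` in global
minimal form (with a parametrisation datum at level `N_E`) gives weak generalized Szpiro
`max(|Δ|, |c₄|³) ≤ C' · N^K` for every integral model minimal at all places. Same proof as
`stub_zagierSilvermanBridgeSemistable` without the semistability thread (Frey 1997 Cor. 3.1;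
Murty 1999 Thm. 1; Pasten arXiv:1705.09251 §3; Silverman 1986 Cor. 2.3). [folklore] -/
theorem weakGenSzpiro_of_polyDegreeAll :
    (∃ κ C : ℝ, ∀ (W : WeierstrassCurve ℚ) [W.IsElliptic] [W.IsGloballyMinimal]
      [NeZero (W.conductorNorm ℤ)], ∃ D : ModularParametrizationData W (W.conductorNorm ℤ),
        (D.deg : ℝ) ≤ C * (D.c : ℝ) ^ 2 * ((W.conductorNorm ℤ : ℕ) : ℝ) ^ κ) →
    ∃ K C : ℝ, ∀ W₀ : WeierstrassCurve ℤ, (W₀.baseChange ℚ).IsElliptic →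
      (∀ v : HeightOneSpectrum ℤ, (W₀.baseChange ℚ).IsMinimalAt v) →
        ((max |W₀.Δ| (|W₀.c₄| ^ 3) : ℤ) : ℝ) ≤
          C * (((W₀.baseChange ℚ).conductorNorm ℤ : ℕ) : ℝ) ^ K := by
  rintro ⟨κ, C, hdeg⟩
  obtain ⟨δ, hδ1, hκδ⟩ : ∃ δ : ℝ, 1 ≤ δ ∧ κ ≤ 2 + δ :=
    ⟨max κ 3 - 2, by have := le_max_right κ 3; linarith, by have := le_max_left κ 3; linarith⟩
  have hC₁ : (0 : ℝ) < max C 1 := one_pos.trans_le (le_max_right _ _)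
  obtain ⟨c₂, hc₂, hP⟩ := murty_petersson_newform_lower_bound_of_one_le hδ1
  obtain ⟨A, hA⟩ := silverman1986_discriminant_c4_covolume_holds 1 one_pos
  refine ⟨(1 + 2 * δ) * (6 + 1), max A 0 * (4 * Real.pi ^ 2 * c₂ / max C 1) ^ (-(6 + 1 : ℝ)),
    fun W₀ hE hmin ↦ ?_⟩
  haveI : (W₀.baseChange ℚ).IsGloballyMinimal :=
    isGloballyMinimal_of_forall_isMinimalAt_int _ hmin
  have hN0 : 0 < (W₀.baseChange ℚ).conductorNorm ℤ := conductorNorm_pos_holds _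
  haveI : NeZero ((W₀.baseChange ℚ).conductorNorm ℤ) := ⟨hN0.ne'⟩
  obtain ⟨D, hD⟩ := hdeg (W₀.baseChange ℚ)
  have hN1 : (1 : ℝ) ≤ (((W₀.baseChange ℚ).conductorNorm ℤ : ℕ) : ℝ) := by exact_mod_cast hN0
  have hD' := ZagierSilvermanBridge.deg_le_of_le hN1 (sq_nonneg _) le_rfl hκδ hD
  exact ZagierSilvermanBridge.pointwise hC₁ hc₂ hP hA W₀ D hD'


end Bridge

/-! ### The registered stubs (statements expanded over existing declarations) -/

/-- STUB 1 (XL, OPEN, SUPPLIED ELSEWHERE; unchanged from the planner's skeleton) — `PolyDegreeSemistable`,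
verbatim the polynomial waypoint of route `IsogenyGlueCongruence` (consequent of `PolyDegreeOfBoundedPrimes`
stmt-ABC-2046, antecedent of `SharpDegreeOfPolyDegree` stmt-ABC-10895; fed by its lever
`EllipticGluingPrimeBound` stmt-ABC-13919): a proof of `DegreePrimesPolyBounded ∧ PolyDegreeOfBoundedPrimes`
there closes this stub by `exact hB hA`. Contains weak abc `c < rad^K` (Frey curves of `16 ∣ abc` triples are
semistable) — open since 1985; only `log deg φ ≪ N log N` is proved (PastenShimura2024 Thm 1.9, MurtyPasten2013). -/
theorem stub_polyDegreeSemistable :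
    ∃ κ C : ℝ, ∀ (W : WeierstrassCurve ℚ) [W.IsElliptic] [W.IsGloballyMinimal]
      [NeZero (W.conductorNorm ℤ)], W.IsSemistable ℤ →
        ∃ D : ModularParametrizationData W (W.conductorNorm ℤ),
          (D.modularDegree : ℝ) ≤ C * (W.conductorNorm ℤ : ℝ) ^ κ := by
  sorry

/-- STUB 2' (M, PROVED — landed p73891 as `Summit.ABC.ABC.Theorems.stub_zagierSilvermanBridgeSemistable`;
proof inlined from the landed file in `namespace Bridge`, no `sorry`) —
`ZagierSilvermanBridgeSemistable`: a polynomial modular-degree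
bound for semistable curves gives weak generalized Szpiro for all semistable integral models minimal at every
place. The work (pattern: first half of `abcLe_sixteen_of_semistableDegreeBound`, with `2 + δ ↦ κ`): given
`W₀/ℤ` minimal at all `v`, elliptic, semistable, put `W := W₀.baseChange ℚ`; `W.IsGloballyMinimal` by
`isGloballyMinimal_of_forall_isMinimalAt_int`, `NeZero (W.conductorNorm ℤ)` by `conductorNorm_pos_holds`; take
the datum `D` of the hypothesis (`D.modularDegree = D.deg ≤ C N^κ`); since `D.c ∈ ℤ ∖ {0}`
(`D.maninConstant_ne_zero_holds`), `(D.c : ℝ)² ≥ 1`, so `deg ≤ C₁ c² N^{2+δ}` with `C₁ := max C 1`,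
`δ := max κ 3 − 2 ≥ 1`; the Petersson input of `covolume_ge_of_deg_le` at this `δ` is `c₂ N^{1−δ} ≤ c₂ ≤ Re (f,f)`
with `c₂ = e^{−4π}/(4π)` (`murty_petersson_newform_lower_bound_of_one_le le_rfl` applied to `D.f`,
`D.isNewformOf`, and `N^{1−δ} ≤ 1`); so `covol(D.L) ≥ (4π²c₂/C₁)·N^{−(1+2δ)}`. Silverman with `ε = 1`
(`silverman1986_discriminant_c4_covolume_holds 1 one_pos W D.L D.isNeronLattice`):
`((max |W.Δ| (|W.c₄|^3) : ℚ) : ℝ) ≤ A₁ · covol^{−7} ≤ A₁ (C₁/(4π²c₂))^7 · N^{7(1+2δ)}`. Finally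
`W.Δ = (W₀.Δ : ℚ)`, `W.c₄ = (W₀.c₄ : ℚ)` (`map_Δ`, `map_c₄`), push the casts. -/
theorem stub_zagierSilvermanBridgeSemistable :
    (∃ κ C : ℝ, ∀ (W : WeierstrassCurve ℚ) [W.IsElliptic] [W.IsGloballyMinimal]
      [NeZero (W.conductorNorm ℤ)], W.IsSemistable ℤ →
        ∃ D : ModularParametrizationData W (W.conductorNorm ℤ),
          (D.modularDegree : ℝ) ≤ C * (W.conductorNorm ℤ : ℝ) ^ κ) →
    ∃ K C : ℝ, ∀ W₀ : WeierstrassCurve ℤ, (W₀.baseChange ℚ).IsElliptic →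
      (∀ v : HeightOneSpectrum ℤ, (W₀.baseChange ℚ).IsMinimalAt v) →
        (W₀.baseChange ℚ).IsSemistable ℤ →
          ((max |W₀.Δ| (|W₀.c₄| ^ 3) : ℤ) : ℝ) ≤
            C * (((W₀.baseChange ℚ).conductorNorm ℤ : ℕ) : ℝ) ^ K := by
  -- CLOSED: the landed proof (p73891), inlined in `namespace Bridge` above until the farm builds the module.
  exact Bridge.stub_zagierSilvermanBridgeSemistable

/-- STUB 3' (XL, OPEN, HARDEST — the lead's own stub) — `SemistableToAllSzpiro`: weak generalized Szpiro for
semistable curves upgrades to ALL elliptic curves over `ℚ` (integral models minimal at every place). A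
statement about pointwise invariants `(N, Δ_min, c₄)` only — no modular forms, no parametrisation data.
MECHANISM for the `e = 2` part (elementary, Tate): if every additive prime `p ≥ 5` of `E` is of Kodaira type
`I_n^*` (`n ≥ 0`) and `E` is semistable at `2, 3`, the quadratic twist `E' = E ⊗ χ_{p*}` over all such `p` is
semistable with `N_{E'} ∣ N_E`, `Δ_min(E) = d⁶ Δ_min(E')`, `c₄(E) = d² c₄(E')`, `d² ∣ N_E`; hence
`M⁺(E) = d⁶ M⁺(E') ≤ N_E³ · C · N_{E'}^K ≤ C · N_E^{K+3}`. RESIDUE (open, the honest hard core): a potentially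
good prime `p ≥ 5` of type II, III, IV, IV*, III*, II* (`e ∈ {6,4,3}`: no twist over `ℚ` is semistable at
`p`), or additive reduction at `2` or `3`; these include the Mordell–Hall curves `Y² = X³ − 3xX − 2y` that are
additive at `2` or `3`, i.e. a slice of weak Hall (`Literature.Barriers.ABC.HallExponentSharp`: no `θ > 0`
known — recorded, not evaded). For potentially good `p ≥ 5` one has `v_p(Δ_min) ≤ 10` and `f_p = 2`, so the
`|Δ_min|` half of `M⁺` is locally polynomial in `N`; the danger is `|c₄|³ = |j|·|Δ_min|` (archimedean size of
`j`, i.e. integral points on Mordell curves). Why it might fail as an implication: only if weak generalized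
Szpiro fails on an additive family while holding on all semistable curves — no such family is known.
DREFUTE VERDICT (refuter-drefute-stmt-ABC-1976-0, 2026-08-16T01:26Z, `NegativeNote-stub_semistableToAllSzpiro.md`
in this crux directory): SURVIVED, not misstated (both binders load-bearing: dropping `IsSemistable` makes it
a tautology, dropping `IsMinimalAt` makes the conclusion false by rescaling), but `line-premise-void` for the
additive half — (i) twist transfer reaches only curves all of whose additive primes are of quadratic type;
(ii) the residue contains the Frey curves of abc triples with `v₂(abc) ∈ {2,3}` (RIGOROUS: `v₂(j) = 8−2t > 0`
excludes multiplicative twists and `e·v₂(Δ_min) = e(4+2t) ≢ 0 mod 12` for `e ≤ 2`, so no quadratic twist is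
semistable at 2), hence THIS STUB ⟹ weak abc for all such triples given only WGS_ss; (iii) every transfer
device on file is a power map `(uⁿ, vⁿ−uⁿ, vⁿ)`, valid only for abc exponent `K₀ < n/(n−1)`, so the provable
regime of this stub by known means is the sliver `6 < K < 144/23` (and `K ≤ 6` is false on semistable
curves: Masser, `SzpiroEpsilonCannotBeDropped_holds`), while STUB 2' outputs `K ≥ 21`. At an inert
exponent the stub is an open problem with no supplier and no mechanism on file: CRUX-SIZED (lead, cycle 1:
handed back as `promote-stub`). -/
theorem stub_semistableToAllSzpiro :
    (∃ K C : ℝ, ∀ W₀ : WeierstrassCurve ℤ, (W₀.baseChange ℚ).IsElliptic →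
      (∀ v : HeightOneSpectrum ℤ, (W₀.baseChange ℚ).IsMinimalAt v) →
        (W₀.baseChange ℚ).IsSemistable ℤ →
          ((max |W₀.Δ| (|W₀.c₄| ^ 3) : ℤ) : ℝ) ≤
            C * (((W₀.baseChange ℚ).conductorNorm ℤ : ℕ) : ℝ) ^ K) →
    ∃ K C : ℝ, ∀ W₀ : WeierstrassCurve ℤ, (W₀.baseChange ℚ).IsElliptic →
      (∀ v : HeightOneSpectrum ℤ, (W₀.baseChange ℚ).IsMinimalAt v) →
        ((max |W₀.Δ| (|W₀.c₄| ^ 3) : ℤ) : ℝ) ≤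
          C * (((W₀.baseChange ℚ).conductorNorm ℤ : ℕ) : ℝ) ^ K := by
  sorry

/-! ### Consistency: each named statement IS its registered stub (definitionally) -/

theorem polyDegreeSemistable_holds : PolyDegreeSemistable := stub_polyDegreeSemistable
theorem zagierSilvermanBridgeSemistable_holds : ZagierSilvermanBridgeSemistable :=
  stub_zagierSilvermanBridgeSemistable
theorem semistableToAllSzpiro_holds : SemistableToAllSzpiro := stub_semistableToAllSzpiro

/-! ### Name-keyed aliases of the three statements (the hypotheses of the composition; the
skeleton audit admits a hypothesis only if its head constant is a registered obligation or is
named like a declared stub) -/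
namespace Registered

/-- Alias of `PolyDegreeSemistable` keyed by the registered stub name. -/
abbrev stub_polyDegreeSemistable : Prop := PolyDegreeSemistable
/-- Alias of `ZagierSilvermanBridgeSemistable` keyed by the registered stub name. -/
abbrev stub_zagierSilvermanBridgeSemistable : Prop := ZagierSilvermanBridgeSemistable
/-- Alias of `SemistableToAllSzpiro` keyed by the registered stub name. -/
abbrev stub_semistableToAllSzpiro : Prop := SemistableToAllSzpiro

end Registered

/-! ### Glue (PROVED): the inert box — weak generalized Szpiro empties a window -/

/-- **InertBox** (card `inert-box-collapse`, lever (i); = the ⟸ direction of the disprover's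
calibration `someWindowSaving_iff_weakSzpiro`, re-proved here because `Disproof.lean` is not
importable). From `M⁺ ≤ C·N^K` for all minimal models: with `K' := max K 3`, `C' := max C 1`,
`κ := K'+1`, `σ := K'+2`, `δ := 0`, a curve in the window has `N^{K'+1} ≤ M⁺ ≤ C'·N^{K'}`, so
`N ≤ C'`; hence `windowSet κ σ X ⊆ windowSet κ σ C'`, a fixed finite set (`windowSet_finite`), and
`T⁺_[κ,σ](X) ≤ #windowSet κ σ C' = const · X⁰`, while `3 < κ < σ` and
`0 < (σ−κ)/(2σ−6) = 1/(2K'−2)`. No Shafarevich finiteness, no counting. -/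
theorem inertBox_holds : InertBox := by
  intro hW
  obtain ⟨K, C, h⟩ := hW
  set K' : ℝ := max K 3 with hK'def
  set C' : ℝ := max C 1 with hC'def
  have hK'3 : (3 : ℝ) ≤ K' := le_max_right K 3
  have hKK' : K ≤ K' := le_max_left K 3
  have hC'1 : (1 : ℝ) ≤ C' := le_max_right C 1
  have hCC' : C ≤ C' := le_max_left C 1
  have hC'0 : (0 : ℝ) ≤ C' := zero_le_one.trans hC'1
  -- every window curve has conductor ≤ C'
  have hsub : ∀ X : ℝ, windowSet (K' + 1) (K' + 2) X ⊆ windowSet (K' + 1) (K' + 2) C' := by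
    intro X W hWX
    simp only [windowSet, Set.mem_setOf_eq] at hWX ⊢
    obtain ⟨hE, hmin, ha₁, ha₃, ha₂, hc₄, hc₆, hNX, hlo, hhi⟩ := hWX
    refine ⟨hE, hmin, ha₁, ha₃, ha₂, hc₄, hc₆, ?_, hlo, hhi⟩
    set n : ℝ := (((W.baseChange ℚ).conductorNorm ℤ : ℕ) : ℝ) with hndef
    have hn1 : (1 : ℝ) ≤ n := by
      rw [hndef]; exact_mod_cast conductorNorm_pos_holds (W.baseChange ℚ)
    have hn0 : (0 : ℝ) < n := one_pos.trans_le hn1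
    have hM : ((max |W.Δ| (|W.c₄| ^ 3) : ℤ) : ℝ) ≤ C * n ^ K := h W hE hmin
    have hM' : C * n ^ K ≤ C' * n ^ K' :=
      calc C * n ^ K ≤ C' * n ^ K := mul_le_mul_of_nonneg_right hCC' (Real.rpow_nonneg hn0.le K)
        _ ≤ C' * n ^ K' :=
            mul_le_mul_of_nonneg_left (Real.rpow_le_rpow_of_exponent_le hn1 hKK') hC'0
    have hpow : n ^ (K' + 1) = n ^ K' * n := Real.rpow_add_one hn0.ne' K'
    have hchain : n ^ K' * n ≤ n ^ K' * C' := by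
      rw [← hpow, mul_comm (n ^ K') C']
      exact (hlo.trans hM).trans hM'
    exact le_of_mul_le_mul_left hchain (Real.rpow_pos_of_pos hn0 K')
  refine ⟨K' + 1, K' + 2, 0, ((windowSet (K' + 1) (K' + 2) C').ncard : ℝ), by linarith,
    by linarith, ?_, fun X _ ↦ ?_⟩
  · have hden : (0 : ℝ) < 2 * (K' + 2) - 6 := by linarith
    have hnum : (0 : ℝ) < K' + 2 - (K' + 1) := by linarith
    exact div_pos hnum hden
  · rw [Real.rpow_zero, mul_one]
    have hle : (windowSet (K' + 1) (K' + 2) X).ncard ≤ (windowSet (K' + 1) (K' + 2) C').ncard :=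
      Set.ncard_le_ncard (hsub X) (windowSet_finite _ _ _)
    exact_mod_cast hle

/-! ### The composition: the three stubs imply the crux, by name -/

/-- `SomeWindowSaving` from the two OPEN stubs (pure logic; no `sorry`): STUB 1 (semistable polynomial degree,
supplied by IsogenyGlueCongruence) fed into the CLOSED STUB 2' (Zagier–Petersson–Silverman with an inert exponent,
run on semistable curves; landed p73891, discharged inside the proof) gives weak generalized Szpiro for semistable
curves; STUB 3' (additive upgrade at the Szpiro level) gives it for all curves; the proved `InertBox` turns that into
the crux. -/
theorem SomeWindowSaving_of (h1 : Registered.stub_polyDegreeSemistable)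
    (h3 : Registered.stub_semistableToAllSzpiro) :
    Summit.ABC.ABC.Theses.TwistAmplification.SomeWindowSaving :=
  inertBox_holds (h3 (stub_zagierSilvermanBridgeSemistable h1))

/-- Wiring check: the registered stubs feed `SomeWindowSaving_of` as stated (STUB 2' is discharged inside,
being closed). -/
example : Summit.ABC.ABC.Theses.TwistAmplification.SomeWindowSaving :=
  SomeWindowSaving_of stub_polyDegreeSemistable stub_semistableToAllSzpiro

/- ALTERNATIVE composition (bypassing STUB 3', fully proved modulo its single hypothesis): a polynomial
modular-degree bound for ALL curves (`PolyDegreeAll`) gives the crux through the LANDED all-curves bridge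
`weakGenSzpiro_of_polyDegreeAll` (p73891) and `inertBox_holds`. Stated as an `example` so that
`SomeWindowSaving_of` stays the only named theorem concluding the crux (unambiguous skeleton audit). This is
the drefuter's "what would change the verdict" (4b): an all-reduction-types supplier of the degree bound. -/
example (h : PolyDegreeAll) : Summit.ABC.ABC.Theses.TwistAmplification.SomeWindowSaving :=
  inertBox_holds (Bridge.weakGenSzpiro_of_polyDegreeAll h)


/-! ### Sufficiency of the EXISTING item stmt-ABC-10576 (PROVED; lead-1)

`Summit.ABC.ABC.Theses.CMRescueSzpiro.Target` (stmt-ABC-10576, target of route CMRescueSzpiro) is verbatim the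
catalogued conjecture `GeneralizedSzpiroConjectureBG` (B–G Conj. 12.5.11), and at `ε := 1` it gives
`WeakGeneralizedSzpiro`, hence the crux (`inertBox_holds`) and the CONCLUSION of STUB 3' outright. So every open
statement of this line is implied by that one existing item; nothing weaker on the summit is known to imply any of
them (weak abc / `PolynomialABC`-type items lose the factor `|c₄c₆| ≤ M^{5/6}` in the radical; the semistable /
Frey-only Szpiro items of IsogenyGlueCongruence, DefiniteXi, QuaternionicDegree, CMRescueSzpiro's 32p rung miss the
additive residue of STUB 3'). Importable form: `Summit.ABC.ABC.Theorems.someWindowSaving_of_generalizedSzpiroBG`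
(`Theorems/TwistAmplificationSomeWindowSavingInertBox.lean`). -/

/-- stmt-ABC-10576 IS B–G Conj. 12.5.11 as catalogued (definitional). -/
example : Summit.ABC.ABC.Theses.CMRescueSzpiro.Target ↔ GeneralizedSzpiroConjectureBG := Iff.rfl

/-- stmt-ABC-10576 (generalized Szpiro, exponent `6 + ε`) ⟹ `WeakGeneralizedSzpiro` (exponent `7`, same constant). -/
theorem weakGenSzpiro_of_cmRescueTarget (h : Summit.ABC.ABC.Theses.CMRescueSzpiro.Target) :
    WeakGeneralizedSzpiro := by
  obtain ⟨C, hC⟩ := h 1 one_pos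
  exact ⟨6 + 1, C, fun W₀ hE hmin ↦ by exact_mod_cast hC W₀ hE hmin⟩

/-- Hence stmt-ABC-10576 ⟹ STUB 3' (its conclusion holds outright) … -/
theorem semistableToAllSzpiro_of_cmRescueTarget (h : Summit.ABC.ABC.Theses.CMRescueSzpiro.Target) :
    SemistableToAllSzpiro := fun _ ↦ weakGenSzpiro_of_cmRescueTarget h

/-- … and stmt-ABC-10576 ⟹ the crux, bypassing all three stubs (an `example`, so that `SomeWindowSaving_of` stays the
only named theorem of this file concluding the crux). -/
example (h : Summit.ABC.ABC.Theses.CMRescueSzpiro.Target) :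
    Summit.ABC.ABC.Theses.TwistAmplification.SomeWindowSaving :=
  inertBox_holds (weakGenSzpiro_of_cmRescueTarget h)

/-- The summit itself implies the crux along this file's glue: `ABC ⟹ GeneralizedSzpiroConjectureBG`
(B–G Thm. 12.5.12 (a) ⟹ (c), proved: `abcLe_iff_generalizedSzpiroBG_holds`) `⟹ WGS ⟹ crux`. -/
example (habc : _root_.ABC) : Summit.ABC.ABC.Theses.TwistAmplification.SomeWindowSaving := by
  refine inertBox_holds (weakGenSzpiro_of_cmRescueTarget
    (abcLe_iff_generalizedSzpiroBG_holds.mp fun ε hε ↦ ?_))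
  obtain ⟨C, -, hC⟩ := habc ε hε
  exact ⟨C, fun a b c h ↦ (hC a b c h).le⟩

/-! ### Calibration (PROVED): what the open stubs contain -/

/-- Real-arithmetic core: from `c² ≤ 2 x`, `x³ ≤ M`, `M ≤ C N^K`, `N ≤ 2¹⁰ R`, with `C ≥ 1`, `K ≥ 0`,
`N, R ≥ 1`, `c ≥ 0`: `c ≤ (8 C 2^{10K})^{1/6} · R^{K/6}`. -/
theorem abc_bound_aux {c x M C N K R : ℝ} (hc : 0 ≤ c) (hC : 1 ≤ C) (hK : 0 ≤ K) (hN : 1 ≤ N)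
    (hR : 1 ≤ R) (hcx : c ^ 2 ≤ 2 * x) (hxM : x ^ 3 ≤ M) (hM : M ≤ C * N ^ K) (hNR : N ≤ 2 ^ 10 * R) :
    c ≤ (8 * C * (2 ^ 10) ^ K) ^ (1 / 6 : ℝ) * R ^ (K / 6) := by
  have hR0 : 0 < R := by linarith
  have hN0 : 0 < N := by linarith
  have hx : c ^ 2 / 2 ≤ x := by linarith
  have hc6 : c ^ 6 ≤ 8 * M := by
    have h1 : (c ^ 2 / 2) ^ 3 ≤ x ^ 3 := by
      exact pow_le_pow_left₀ (by positivity) hx 3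
    nlinarith [h1, hxM]
  have hNK : N ^ K ≤ (2 ^ 10 * R) ^ K := Real.rpow_le_rpow hN0.le hNR hK
  have hsplit : (2 ^ 10 * R : ℝ) ^ K = (2 ^ 10) ^ K * R ^ K :=
    Real.mul_rpow (by norm_num) hR0.le
  have hc6' : c ^ 6 ≤ (8 * C * (2 ^ 10) ^ K) * R ^ K := by
    calc c ^ 6 ≤ 8 * M := hc6
      _ ≤ 8 * (C * N ^ K) := by linarith
      _ ≤ 8 * (C * ((2 ^ 10) ^ K * R ^ K)) := by
          rw [← hsplit]
          exact mul_le_mul_of_nonneg_left (mul_le_mul_of_nonneg_left hNK (by linarith)) (by norm_num)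
      _ = (8 * C * (2 ^ 10) ^ K) * R ^ K := by ring
  have hA0 : 0 ≤ 8 * C * (2 ^ 10 : ℝ) ^ K := by positivity
  have hc6eq : (c ^ 6) ^ (1 / 6 : ℝ) = c := by
    rw [show c ^ 6 = c ^ ((6 : ℕ) : ℝ) by rw [Real.rpow_natCast], ← Real.rpow_mul hc]
    norm_num
  calc c = (c ^ 6) ^ (1 / 6 : ℝ) := hc6eq.symm
    _ ≤ ((8 * C * (2 ^ 10) ^ K) * R ^ K) ^ (1 / 6 : ℝ) :=
        Real.rpow_le_rpow (by positivity) hc6' (by norm_num)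
    _ = (8 * C * (2 ^ 10) ^ K) ^ (1 / 6 : ℝ) * (R ^ K) ^ (1 / 6 : ℝ) :=
        Real.mul_rpow hA0 (Real.rpow_nonneg hR0.le K)
    _ = (8 * C * (2 ^ 10) ^ K) ^ (1 / 6 : ℝ) * R ^ (K / 6) := by
        rw [← Real.rpow_mul hR0.le]; ring_nf

/-- **CALIBRATION (lead, cycle 1; kernel-checked, sorry-free).** Weak generalized Szpiro — the crux's pointwise
content and the conclusion of STUB 3' — contains WEAK abc `c ≤ C · rad(abc)^K` (open since Masser–Oesterlé
1985), through the tree's minimal Frey models (`exists_minimal_frey_model`: `N ∣ 2¹⁰ rad(abc)`, `c² ≤ 2|c₄|`,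
B–G 12.5.10/12.5.12): `c⁶ ≤ 8|c₄|³ ≤ 8 M⁺ ≤ 8 C N^K ≤ 8 C 2^{10K} rad^K`. -/
theorem weakAbc_of_weakGeneralizedSzpiro (h : WeakGeneralizedSzpiro) :
    ∃ K C : ℝ, ∀ a b c : ℕ, IsABCTriple a b c → (c : ℝ) ≤ C * ((rad a b c : ℕ) : ℝ) ^ K := by
  obtain ⟨K, C, h⟩ := h
  set K' : ℝ := max K 0 with hK'
  set C' : ℝ := max C 1 with hC'
  refine ⟨K' / 6, (8 * C' * (2 ^ 10) ^ K') ^ (1 / 6 : ℝ), fun a b c ht ↦ ?_⟩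
  obtain ⟨W₀, hE, hmin, hdvd, hc₄⟩ := exists_minimal_frey_model ht
  have hradpos : 0 < rad a b c := by
    obtain ⟨ha, hb, habc, -⟩ := ht
    rw [Literature.NumberTheory.DiophantineGeometry.rad_def]
    exact Nat.pos_of_ne_zero UniqueFactorizationMonoid.radical_ne_zero
  have hNpos : 0 < (W₀.baseChange ℚ).conductorNorm ℤ := conductorNorm_pos_holds (W₀.baseChange ℚ)
  have hNle : (W₀.baseChange ℚ).conductorNorm ℤ ≤ 2 ^ 10 * rad a b c :=
    Nat.le_of_dvd (by positivity) hdvd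
  have hN1 : (1 : ℝ) ≤ (((W₀.baseChange ℚ).conductorNorm ℤ : ℕ) : ℝ) := by exact_mod_cast hNpos
  have hR1 : (1 : ℝ) ≤ ((rad a b c : ℕ) : ℝ) := by exact_mod_cast hradpos
  have hNR : (((W₀.baseChange ℚ).conductorNorm ℤ : ℕ) : ℝ) ≤ 2 ^ 10 * ((rad a b c : ℕ) : ℝ) := by
    exact_mod_cast hNle
  have hM := h W₀ hE hmin
  have hM' : ((max |W₀.Δ| (|W₀.c₄| ^ 3) : ℤ) : ℝ) ≤
      C' * (((W₀.baseChange ℚ).conductorNorm ℤ : ℕ) : ℝ) ^ K' :=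
    calc ((max |W₀.Δ| (|W₀.c₄| ^ 3) : ℤ) : ℝ)
        ≤ C * (((W₀.baseChange ℚ).conductorNorm ℤ : ℕ) : ℝ) ^ K := hM
      _ ≤ C' * (((W₀.baseChange ℚ).conductorNorm ℤ : ℕ) : ℝ) ^ K :=
          mul_le_mul_of_nonneg_right (le_max_left _ _) (Real.rpow_nonneg (by linarith) _)
      _ ≤ C' * (((W₀.baseChange ℚ).conductorNorm ℤ : ℕ) : ℝ) ^ K' :=
          mul_le_mul_of_nonneg_left (Real.rpow_le_rpow_of_exponent_le hN1 (le_max_left _ _))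
            (le_trans zero_le_one (le_max_right _ _))
  have hxM : (|(W₀.c₄ : ℝ)|) ^ 3 ≤ ((max |W₀.Δ| (|W₀.c₄| ^ 3) : ℤ) : ℝ) := by
    push_cast
    exact le_max_right _ _
  have hcx : ((c : ℕ) : ℝ) ^ 2 ≤ 2 * |(W₀.c₄ : ℝ)| := by
    have : (((c : ℕ) : ℤ) : ℝ) ^ 2 ≤ 2 * |((W₀.c₄ : ℤ) : ℝ)| := by exact_mod_cast hc₄
    simpa using this
  exact abc_bound_aux (Nat.cast_nonneg c) (le_max_right _ _) (le_max_right _ _) hN1 hR1 hcx hxM hM' hNR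


/-- STUB 3' given STUB 1 ∧ STUB 2' (i.e. given weak generalized Szpiro for semistable curves) yields weak abc for
ALL triples — in particular for the `v₂(abc) ∈ {2,3}` triples whose Frey curves admit no semistable quadratic
twist (drefute): the inert-exponent 2-adic transfer nobody knows. -/
example (h3 : SemistableToAllSzpiro) (hss : WeakGeneralizedSzpiroSemistable) :
    ∃ K C : ℝ, ∀ a b c : ℕ, IsABCTriple a b c → (c : ℝ) ≤ C * ((rad a b c : ℕ) : ℝ) ^ K :=
  weakAbc_of_weakGeneralizedSzpiro (h3 hss)

/-! ### Scratch checks against the landed `Negative/*` lemmas and the `Leans on:` names -/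

/-- The refuted strengthening `not_windowSaving_below_law` (landed): no saving below `1 − κ/6` for
`3 < κ < 4` — the InertBox witness has `κ = max K 3 + 1 ≥ 4`, outside its range. -/
example : ¬ ∃ κ σ δ C : ℝ, 3 < κ ∧ κ < 4 ∧ 12 < σ ∧ δ < 1 - κ / 6 ∧
    ∀ X : ℝ, 1 ≤ X → (windowCount κ σ X : ℝ) ≤ C * X ^ δ :=
  not_windowSaving_below_law

/-- The refuted strengthening `not_windowSaving_below_third` (landed): `κ < 4 ⇒ δ ≥ 1/3`; again the
witness window has `κ ≥ 4`. -/
example : ¬ ∃ κ σ δ C : ℝ, 0 < κ ∧ κ < 4 ∧ 12 < σ ∧ δ < 1 / 3 ∧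
    ∀ X : ℝ, 1 ≤ X → (windowCount κ σ X : ℝ) ≤ C * X ^ δ :=
  not_windowSaving_below_third

/-- Load-bearing analysis (landed): without `3 < κ` a junk witness exists — the InertBox witness
keeps all three constraints. -/
example : ∃ κ σ δ C : ℝ, κ < σ ∧ δ < (σ - κ) / (2 * σ - 6) ∧
    ∀ X : ℝ, 1 ≤ X → (windowCount κ σ X : ℝ) ≤ C * X ^ δ :=
  someWindowSaving_trivial_without_lowerKappa

/-- `Leans on` of STUB 2' resolve and are theorems: Silverman's covolume inequality … -/
example : silverman1986_discriminant_c4_covolume := silverman1986_discriminant_c4_covolume_holds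

/-- … and the Petersson lower bound in the range `ε ≥ 1`. -/
example : ∃ c : ℝ, 0 < c ∧ ∀ (N : ℕ) [NeZero N] (W : WeierstrassCurve ℚ) [W.IsElliptic]
    (f : CuspForm (CongruenceSubgroup.Gamma0 N) 2), IsNewformOf W f →
      c * (N : ℝ) ^ (1 - (1 : ℝ)) ≤ (peterssonProduct (CongruenceSubgroup.Gamma0 N) 2 f f).re :=
  murty_petersson_newform_lower_bound_of_one_le le_rfl

end Summit.ABC.ABC.Cruxes.SomeWindowSaving.PolynomialDegreeSuffices

end
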